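import Mathlib
import Summits.HodgeConjecture.FermatCycles.HodgeFermatTheoremUEq

/-!
# THEOREM U⁼ with its exceptions LISTED: the all-unit coincidences at `21` and `39` — part 1: kernel enumeration and soundness (`HodgeFermat/CoincEnum.lean`; HF-G27d)

Tree copy (part 1 of 2) of the module `HodgeFermat/CoincEnum.lean` of the sibling cell's standalone package
`run/shared/lean/pub/pub-hodgefermat/lean/HodgeFermat/` (393 lines, sha256 `74a5988e69624d45…`), source lines 30–256 (§1 the Boolean model and the kernel checks `coincCheck_21`/`coincCheck_39`, §2 soundness `coincAt_of_check`, `coincAt_21`, `coincAt_39`).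
Filed by cell `pub-hfermat`, seat prover-1 gen-3, on the COORDINATOR KEEPER RULING of 2026-08-25 (gem sweep H1: take the
off-gate kernel theorem `thmFstar` through the gate) — here THEOREM F* of `tables/DPRIME-THEOREM.md` §9 IN FULL, i.e.
PROPOSITION D′(3N) and the descent (`HodgeFermat/PropDPrimeNFinal.lean`, GATE HF-G34), the last off-gate form of THEOREM F*
(its first two forms, `DecodingFinal.thmFstar` = F* at the prime levels and `ThmFstarNFinal.thmFstar` = F*(3N), landed on
2026-08-25 as `HodgeFermatThmFstar.lean` / `HodgeFermatThmFstarN.lean`, seats prover-1 gen-0 / gen-2); this file is one link of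
the import closure of `PropDPrimeNFinal.propDprime` (the sibling's KR-free chain: THEOREM L, COROLLARY M, THEOREM D6,
THEOREM U⁺, THEOREM KR6, THEOREM Z3U) on top of those landed chains.  The source module is the sibling's hub-checked module of
record (pub-hodgefermat `CERT.md` l.921, GATE HF-G27d); its declarations are copied VERBATIM.
Deviations from the source module, exhaustively: the `import` lines (tree modules `Summits.HodgeConjecture.FermatCycles.
HodgeFermat*` instead of `HodgeFermat.*`); this module docstring; one-line docstrings added (gate lint) to `coincCheck_21`, `coincCheck_39`, `coincCheck_39_nil`, `mem_unitList`, `coprime_mod`, `mem_unitList_mod`, `perm3B_iff`, `exc_of_excB`, `dvd_scale`, `coincAt_21`, `coincAt_39`; the file ends at source l.256 with an `end` line (part 2 = `HodgeFermatCoincEnumB.lean`).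
Every other line — in particular every declaration's statement and proof — is byte-identical to the source.
HONEST FRAMING: explicit algebraic cycles for specific Hodge classes on Fermat/Delsarte varieties; residual open instances
listed; no claim on general Hodge.  (This file is arithmetic of CM types / finite combinatorics / analytic number theory
of the sibling's KR-free programme; it claims nothing about cycles.)

The source module's docstring (CoincEnum.lean l.6–28), verbatim:

## THEOREM U⁼ with its exceptions LISTED: the all-unit coincidences at `21` and `39` — kernel enumeration (HF-G27d)

`TheoremUEq.thmUEq` (THEOREM U⁼) excludes the levels `21` and `39`, where distinct all-unit triples with the same CM
type exist (`tables/SEMI-THEOREM.md` §4.2: at `21` the class of `(1, 4, 16) ∼ (2, 8, 11)` — Koblitz–Rohrlich's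
`J_(1,4,16) ≅ E⁶` — and its negative; at `39` the class `{(1,16,22), (2,5,32), (4,10,25), (8,11,20)}` and its negative).
This LIGHT module (imports `TheoremUEq` only) puts the COMPLETE LIST into the kernel: `coincCheck N pats` runs over all
pairs of all-unit zero-sum triples `(1, b, c)`, `(a', b', c')` of residues mod `N` (the first one normalised to contain
`1`, which is no loss by scaling), and whenever they have the same CM type checks that they are permutations of each
other or of one of the listed shapes `t·(p₁, p₂, p₃)`, `t·(q₁, q₂, q₃)` (`t` a unit); `coincCheck_21`, `coincCheck_39`
evaluate it by `decide +kernel` (no `native_decide`) on the patterns `(1,4,16 | 2,8,11)` and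
`(1,16,22 | 2,32,5), (1,16,22 | 4,25,10), (1,16,22 | 8,11,20)`, and `coincAt_of_check` is its soundness:

* `coincidences_21` : two all-unit zero-sum triples mod `21` with the same CM type are permutations of each other, or
  `{a, b, c} = {t, 4t, 16t}` and `{a', b', c'} = {2t, 8t, 11t}` for some `t ∈ ℤ/21`;
* `coincidences_39` : the same at `39` with `{t, 16t, 22t}` and `{2t, 32t, 5t}`, `{4t, 25t, 10t}` or `{8t, 11t, 20t}`;
* conversely these shapes ARE coincidences for every unit `t` (`sameType_21`, `sameType_39₂`, `sameType_39₄`,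
  `sameType_39₈`), and the check with NO pattern fails at `21`, `39` and passes at `15` (`coincCheck_21_nil`,
  `coincCheck_39_nil`, `coincCheck_15_nil` — THEOREM U⁼ at `15` by pure enumeration, `eqAt_15`).

`ThmUList` / `thmUList_of : ThmUEq → ThmUList` combine this with THEOREM U⁼: the complete description of the all-unit
CM-type coincidences at every odd level (no-binder form `CoincEnumFinal.thmUList`).
-/

set_option autoImplicit false

namespace HodgeFermat.KRFree.CoincEnum

open HodgeFermat.KRFree.LemmaN HodgeFermat.KRFree.TheoremUEq

/-! ## The checker -/

/-- the units of `ℤ/N`, as natural representatives `< N` -/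
def unitList (N : ℕ) : List ℕ := (List.range N).filter fun x => Nat.gcd x N == 1

/-- `t ∈ H_{(a, b, ·)}`: `⟨ta⟩_N + ⟨tb⟩_N < N` -/
def inHB (N a b t : ℕ) : Bool := decide (t * a % N + t * b % N < N)

/-- same CM type of `(a, b, ·)` and `(a', b', ·)`, tested on the unit residues -/
def sameTypeB (N a b a' b' : ℕ) : Bool := (unitList N).all fun t => inHB N a b t == inHB N a' b' t

/-- `(A, B, C)` is a permutation of `(A', B', C')` -/
def perm3B (A B C A' B' C' : ℕ) : Bool :=
  (A == A' && B == B' && C == C') || (A == A' && B == C' && C == B') ||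
    (A == B' && B == A' && C == C') || (A == B' && B == C' && C == A') ||
    (A == C' && B == A' && C == B') || (A == C' && B == B' && C == A')

/-- the forced third entry `c ≡ −(a + b) (mod N)`, `c < N` -/
def third (N a b : ℕ) : ℕ := (N - (a + b) % N) % N

/-- an exceptional shape: `(p₁, p₂, p₃ | q₁, q₂, q₃)` stands for the pairs `t·(p₁, p₂, p₃)`, `t·(q₁, q₂, q₃)` -/
abbrev Pat : Type := ℕ × ℕ × ℕ × ℕ × ℕ × ℕ

/-- the pair of triples is of one of the listed shapes, for some unit `t` -/
def excB (N : ℕ) (pats : List Pat) (a b c a' b' c' : ℕ) : Bool :=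
  (unitList N).any fun t => pats.any fun p =>
    perm3B a b c (t * p.1 % N) (t * p.2.1 % N) (t * p.2.2.1 % N) &&
      perm3B a' b' c' (t * p.2.2.2.1 % N) (t * p.2.2.2.2.1 % N) (t * p.2.2.2.2.2 % N)

/-- one pair `(1, b, c)`, `(a', b', c')` (`c`, `c'` forced): if all-unit and of the same CM type, it is a permutation
pair or of a listed shape -/
def coincStep (N : ℕ) (pats : List Pat) (b a' b' : ℕ) : Bool :=
  !(Nat.gcd (third N 1 b) N == 1) || !(Nat.gcd (third N a' b') N == 1) || !(sameTypeB N 1 b a' b') ||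
    perm3B 1 b (third N 1 b) a' b' (third N a' b') || excB N pats 1 b (third N 1 b) a' b' (third N a' b')

/-- the finite check at level `N` against the pattern list `pats` -/
def coincCheck (N : ℕ) (pats : List Pat) : Bool :=
  (unitList N).all fun b => (unitList N).all fun a' => (unitList N).all fun b' => coincStep N pats b a' b'

/-- the exceptional shapes at `21`: `(1, 4, 16 | 2, 8, 11)` -/
def pats21 : List Pat := [(1, 4, 16, 2, 8, 11)]

/-- the exceptional shapes at `39`: `(1, 16, 22 | 2, 32, 5)`, `(1, 16, 22 | 4, 25, 10)`, `(1, 16, 22 | 8, 11, 20)` -/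
def pats39 : List Pat := [(1, 16, 22, 2, 32, 5), (1, 16, 22, 4, 25, 10), (1, 16, 22, 8, 11, 20)]

/-! ## Kernel evaluations -/

/-- kernel enumeration: every all-unit coincidence at level 21 is listed in `pats21` -/
theorem coincCheck_21 : coincCheck 21 pats21 = true := by decide +kernel

/-- kernel enumeration: every all-unit coincidence at level 39 is listed in `pats39` -/
theorem coincCheck_39 : coincCheck 39 pats39 = true := by decide +kernel

/-- with NO exceptional shape the check fails at `21` and `39` (the coincidences exist) … -/
theorem coincCheck_21_nil : coincCheck 21 [] = false := by decide +kernel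

/-- control: the empty exception list fails at level 39 -/
theorem coincCheck_39_nil : coincCheck 39 [] = false := by decide +kernel

/-- … and passes at `15` (THEOREM U⁼ at `15` by pure enumeration; cf. `s(15) = 0`). -/
theorem coincCheck_15_nil : coincCheck 15 [] = true := by decide +kernel

/-! ## Soundness -/

/-- the listed shapes as a proposition on residues: `(A, B, C) ~ t·(p₁, p₂, p₃)`, `(A', B', C') ~ t·(q₁, q₂, q₃)` -/
def Exc (N : ℕ) (pats : List Pat) (A B C A' B' C' : ℕ) : Prop :=
  ∃ t : ℕ, t < N ∧ Nat.Coprime t N ∧ ∃ p ∈ pats,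
    Perm3 A B C (t * p.1 % N) (t * p.2.1 % N) (t * p.2.2.1 % N) ∧
      Perm3 A' B' C' (t * p.2.2.2.1 % N) (t * p.2.2.2.2.1 % N) (t * p.2.2.2.2.2 % N)

/-- the conclusion at level `N`: permutation pair or listed shape -/
def CoincAt (N : ℕ) (pats : List Pat) : Prop :=
  ∀ a b c a' b' c' : ℕ,
    N ∣ a + b + c → N ∣ a' + b' + c' →
    Nat.Coprime a N → Nat.Coprime b N → Nat.Coprime c N →
    Nat.Coprime a' N → Nat.Coprime b' N → Nat.Coprime c' N →
    SameType N (a, b, c) (a', b', c') →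
    Perm3 (a % N) (b % N) (c % N) (a' % N) (b' % N) (c' % N) ∨
      Exc N pats (a % N) (b % N) (c % N) (a' % N) (b' % N) (c' % N)

/-- membership in `unitList N` -/
lemma mem_unitList {N x : ℕ} : x ∈ unitList N ↔ x < N ∧ Nat.Coprime x N := by
  simp [unitList, List.mem_filter, List.mem_range, Nat.Coprime]

/-- the residue of a unit is a unit -/
lemma coprime_mod {N x : ℕ} (hx : Nat.Coprime x N) : Nat.Coprime (x % N) N := by
  unfold Nat.Coprime at *
  rw [← hx, Nat.gcd_comm x N]
  exact (Nat.gcd_rec N x).symm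

/-- the residue of a unit lies in `unitList N` -/
lemma mem_unitList_mod {N x : ℕ} (hN : 0 < N) (hx : Nat.Coprime x N) : x % N ∈ unitList N :=
  mem_unitList.mpr ⟨Nat.mod_lt x hN, coprime_mod hx⟩

/-- the Boolean `perm3B` decides `Perm3` -/
lemma perm3B_iff {A B C A' B' C' : ℕ} : perm3B A B C A' B' C' = true ↔ Perm3 A B C A' B' C' := by
  simp only [perm3B, Perm3, Bool.or_eq_true, Bool.and_eq_true, beq_iff_eq, or_assoc, and_assoc]

/-- soundness of the Boolean exception test `excB` -/
lemma exc_of_excB {N : ℕ} {pats : List Pat} {A B C A' B' C' : ℕ} (h : excB N pats A B C A' B' C' = true) :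
    Exc N pats A B C A' B' C' := by
  obtain ⟨t, ht, h⟩ := List.any_eq_true.mp h
  obtain ⟨p, hp, h⟩ := List.any_eq_true.mp h
  rw [Bool.and_eq_true, perm3B_iff, perm3B_iff] at h
  obtain ⟨htN, htc⟩ := mem_unitList.mp ht
  exact ⟨t, htN, htc, p, hp, h.1, h.2⟩

/-- `inHB` on residues is membership in `H_T` -/
lemma inHB_iff {N a b t : ℕ} (c : ℕ) : inHB N (a % N) (b % N) t = true ↔ InH N (a, b, c) t := by
  simp only [inHB, InH, Nat.mul_mod_mod, decide_eq_true_eq]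

/-- the forced third entry of a zero-sum triple is the residue of its third entry -/
lemma third_mod {N x y c : ℕ} (hN : 0 < N) (h : N ∣ x + y + c) : third N (x % N) (y % N) = c % N := by
  haveI : NeZero N := ⟨by omega⟩
  have h0 := (ZMod.natCast_eq_zero_iff (x + y + c) N).mpr h
  have hc : (c : ZMod N) = -((x + y : ℕ) : ZMod N) := by
    push_cast at h0 ⊢
    linear_combination h0
  have hv := congrArg ZMod.val hc
  rw [ZMod.val_natCast, ZMod.neg_val', ZMod.val_natCast] at hv
  rw [hv, third, Nat.add_mod x y N]

/-- the step of the checker at three unit residues -/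
lemma step_of_check {N : ℕ} {pats : List Pat} (hq : coincCheck N pats = true) {b a' b' : ℕ}
    (hb : b ∈ unitList N) (ha' : a' ∈ unitList N) (hb' : b' ∈ unitList N) : coincStep N pats b a' b' = true :=
  List.all_eq_true.mp (List.all_eq_true.mp (List.all_eq_true.mp hq _ hb) _ ha') _ hb'

/-- **Soundness, normalised form**: first entry `≡ 1`. -/
theorem coinc_one {N : ℕ} (h1 : 1 < N) {pats : List Pat} (hq : coincCheck N pats = true)
    {A B C A' B' C' : ℕ} (hA : A % N = 1) (hs : N ∣ A + B + C) (hs' : N ∣ A' + B' + C')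
    (hB : Nat.Coprime B N) (hC : Nat.Coprime C N)
    (hA' : Nat.Coprime A' N) (hB' : Nat.Coprime B' N) (hC' : Nat.Coprime C' N)
    (hT : SameType N (A, B, C) (A', B', C')) :
    Perm3 (A % N) (B % N) (C % N) (A' % N) (B' % N) (C' % N) ∨
      Exc N pats (A % N) (B % N) (C % N) (A' % N) (B' % N) (C' % N) := by
  have hN : 0 < N := by omega
  have step := step_of_check hq (mem_unitList_mod hN hB) (mem_unitList_mod hN hA') (mem_unitList_mod hN hB')
  have h3 : third N 1 (B % N) = C % N := by
    have h := third_mod (x := A) (y := B) hN hs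
    rwa [hA] at h
  have h3' : third N (A' % N) (B' % N) = C' % N := third_mod hN hs'
  have gC : (Nat.gcd (C % N) N == 1) = true := beq_iff_eq.mpr (coprime_mod hC)
  have gC' : (Nat.gcd (C' % N) N == 1) = true := beq_iff_eq.mpr (coprime_mod hC')
  have hTB : sameTypeB N 1 (B % N) (A' % N) (B' % N) = true := by
    have h : sameTypeB N (A % N) (B % N) (A' % N) (B' % N) = true := by
      refine List.all_eq_true.mpr fun t ht => beq_iff_eq.mpr (Bool.eq_iff_iff.mpr ?_)
      rw [inHB_iff C, inHB_iff C']
      exact hT t (mem_unitList.mp ht).2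
    rwa [hA] at h
  rw [coincStep, h3, h3', gC, gC', hTB] at step
  have h2 : perm3B 1 (B % N) (C % N) (A' % N) (B' % N) (C' % N) = true ∨
      excB N pats 1 (B % N) (C % N) (A' % N) (B' % N) (C' % N) = true := by simpa using step
  rw [hA]
  rcases h2 with h | h
  · exact Or.inl (perm3B_iff.mp h)
  · exact Or.inr (exc_of_excB h)

/-- an inverse mod `N` of a unit, as a natural number -/
lemma exists_inverse {N a : ℕ} (h1 : 1 < N) (ha : Nat.Coprime a N) : ∃ u : ℕ, Nat.Coprime u N ∧ u * a % N = 1 := by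
  haveI : NeZero N := ⟨by omega⟩
  haveI : Fact (1 < N) := ⟨h1⟩
  refine ⟨(((ZMod.unitOfCoprime a ha)⁻¹ : (ZMod N)ˣ) : ZMod N).val,
    ZMod.val_coe_unit_coprime (ZMod.unitOfCoprime a ha)⁻¹, ?_⟩
  rw [← ZMod.val_natCast, Nat.cast_mul, ZMod.natCast_zmod_val, ← ZMod.coe_unitOfCoprime a ha, Units.inv_mul,
    ZMod.val_one]

/-- scaling a triple by `u` moves `t ∈ H` to `tu ∈ H` -/
lemma inH_scale (N u a b c t : ℕ) : InH N (u * a, u * b, u * c) t ↔ InH N (a, b, c) (t * u) := by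
  show t * (u * a) % N + t * (u * b) % N < N ↔ t * u * a % N + t * u * b % N < N
  rw [Nat.mul_assoc, Nat.mul_assoc]

/-- the CM-type relation is invariant under scaling both triples by a unit -/
lemma sameType_scale {N u a b c a' b' c' : ℕ} (hu : Nat.Coprime u N) (h : SameType N (a, b, c) (a', b', c')) :
    SameType N (u * a, u * b, u * c) (u * a', u * b', u * c') :=
  fun t ht => (inH_scale N u a b c t).trans
    ((h (t * u) (Nat.coprime_mul_iff_left.mpr ⟨ht, hu⟩)).trans (inH_scale N u a' b' c' t).symm)

/-- scaling a zero-sum triple by `u` keeps it zero-sum -/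
lemma dvd_scale {N a b c : ℕ} (u : ℕ) (h : N ∣ a + b + c) : N ∣ u * a + u * b + u * c := by
  rw [← Nat.mul_add, ← Nat.mul_add]
  exact Dvd.dvd.mul_left h u

/-- **Soundness of the checker.**  If `coincCheck N pats` passes (`N > 1`), two all-unit zero-sum triples mod `N` with
the same CM type are permutations of each other or of one of the listed shapes. -/
theorem coincAt_of_check {N : ℕ} (h1 : 1 < N) {pats : List Pat} (hq : coincCheck N pats = true) :
    CoincAt N pats := by
  intro a b c a' b' c' hs hs' ha hb hc ha' hb' hc' hT
  have hN : 0 < N := by omega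
  obtain ⟨u, hu, hua⟩ := exists_inverse h1 ha
  have cop : ∀ {x : ℕ}, Nat.Coprime x N → Nat.Coprime (u * x) N := fun hx => Nat.coprime_mul_iff_left.mpr ⟨hu, hx⟩
  have key := coinc_one h1 hq hua (dvd_scale u hs) (dvd_scale u hs') (cop hb) (cop hc) (cop ha') (cop hb') (cop hc')
    (sameType_scale hu hT)
  -- undo the scaling: multiply by `a`
  have hau : a * u ≡ 1 [MOD N] := by
    show a * u % N = 1 % N
    rw [Nat.mod_eq_of_lt h1, Nat.mul_comm]
    exact hua
  have un : ∀ x : ℕ, a * (u * x % N) % N = x % N := fun x =>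
    ((Nat.mod_modEq (u * x) N).mul_left a).trans
      (by rw [← Nat.mul_assoc]; exact (hau.mul_right x).trans (by rw [Nat.one_mul]))
  have sc : ∀ t q : ℕ, a * (t * q % N) % N = a * t % N * q % N := fun t q =>
    ((Nat.mod_modEq (t * q) N).mul_left a).trans
      (by rw [← Nat.mul_assoc]; exact ((Nat.mod_modEq (a * t) N).mul_right q).symm)
  rcases key with h | ⟨t, -, htc, p, hp, hP, hP'⟩
  · left
    have h' := h.map (fun X => a * X % N)
    simp only [un] at h'
    exact h'
  · right
    refine ⟨a * t % N, Nat.mod_lt _ hN, coprime_mod (Nat.coprime_mul_iff_left.mpr ⟨ha, htc⟩), p, hp, ?_, ?_⟩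
    · have h' := hP.map (fun X => a * X % N)
      simp only [un, sc] at h'
      exact h'
    · have h' := hP'.map (fun X => a * X % N)
      simp only [un, sc] at h'
      exact h'

/-- THEOREM U⁼ at a level from the check with NO exceptional shape. -/
theorem eqAt_of_check_nil {N : ℕ} (h1 : 1 < N) (hq : coincCheck N [] = true) : EqAt N :=
  fun a b c a' b' c' hs hs' ha hb hc ha' hb' hc' hT =>
    (coincAt_of_check h1 hq a b c a' b' c' hs hs' ha hb hc ha' hb' hc' hT).elim id
      fun ⟨_, _, _, _, hp, _⟩ => absurd hp List.not_mem_nil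

/-- THEOREM U⁼ at `15`, by pure enumeration. -/
theorem eqAt_15 : EqAt 15 := eqAt_of_check_nil (by norm_num) coincCheck_15_nil

/-- at level 21 every all-unit coincidence is trivial or listed (`pats21`) -/
theorem coincAt_21 : CoincAt 21 pats21 := coincAt_of_check (by norm_num) coincCheck_21

/-- at level 39 every all-unit coincidence is trivial or listed (`pats39`) -/
theorem coincAt_39 : CoincAt 39 pats39 := coincAt_of_check (by norm_num) coincCheck_39


end HodgeFermat.KRFree.CoincEnum
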